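import Literature.AlgebraicGeometry.Motives.HodgeStructureOfAbelianVarietyBiproduct
import Literature.AlgebraicGeometry.Motives.HodgeLieDirectSum
import Literature.AlgebraicGeometry.Pohlmann1968.SimpleCMAbelianVarietyHazamaCriterion
import HarnessLib

/-!
# The Lie algebra of the Hodge group of `H¹` of a complex abelian variety: isogeny invariance of its dimension, and
# `dim Lie Hg(H¹(⨁ₗ Bₗ^{nₗ+1})) ≤ Σₗ dim Lie Hg(H¹Bₗ)`

Family `hodge`, layer `Literature/AlgebraicGeometry/Motives`; theorems only, no definition, no named fact.  Written for the cell
`pub-hodgecm2` (COR-CM), seat `b27` gen 35 (count-neutral; the Literature-level form of §1 of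
`Summits/HodgeConjecture/CorCM/MumfordTateRankFiveConverse`, so that Literature files can use it).  Inputs: Künneth in degree
one as an isomorphism of `ℚ`-Hodge structures (`AbelianVariety.pi_hodge_one_eq_comapEquiv_biproduct`), an isogeny identifies the
Hodge structures on `H¹` (`Pohlmann1968.hodge_one_eq_comapEquiv_of_isIsogeny`), and the abstract Lie lemmas of
`Motives/HodgeLieDirectSum` (`finrank_hodgeLie_comapEquiv`, `finrank_hodgeLie_pi_le_sum`, `finrank_hodgeLie_pi_const_le`).

* `finrank_hodgeLie_hodge_one_eq_of_isIsogeny` / `…_of_isIsogenous` — `dim_ℚ Lie Hg(H¹X) = dim_ℚ Lie Hg(H¹X')` for isogenous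
  `X`, `X'` (companion of `Pohlmann1968.mtRank_hodge_one_eq_of_isIsogenous`);
* `finrank_hodgeLie_hodge_one_biproduct_le_sum` — `dim Lie Hg(H¹(⨁ⱼ Aⱼ)) ≤ Σⱼ dim Lie Hg(H¹Aⱼ)` (Moonen–Zarhin §3:
  `Hg(X₁ × X₂) ⊆ Hg(X₁) × Hg(X₂)`, Lie-algebra form);
* `finrank_hodgeLie_hodge_one_biproduct_const_le` — `dim Lie Hg(H¹(⨁_{Fin (m+1)} B)) ≤ dim Lie Hg(H¹B)` (`Hg(Bᵐ) = Hg(B)`).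
The composite bound for `X ∼ ⨁ₗ Bₗ^{nₗ+1}` (`dim Lie Hg(H¹X) ≤ Σₗ dim Lie Hg(H¹Bₗ)`) is
`Summit.HodgeConjecture.CorCM.finrank_hodgeLie_hodge_one_le_sum_of_isIsogenous_biproduct_powers`; the three lemmas here are
its Literature-level ingredients.

## References
* [MoonenZarhin1999LowDim] B. Moonen, Yu. Zarhin, Math. Ann. 315 (1999) 711–733, §3 first paragraph [corpus: paper:arxiv-math_9901113 p. 6].
  [cite: MoonenZarhin1999LowDim, §3]
* [Deligne1982HodgeCycles] P. Deligne, *Hodge cycles on abelian varieties*, LNM 900 (1982), I §3.1 and Prop. 3.4.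
  [cite: Deligne1982HodgeCycles, I §3.1 and Prop. 3.4]
* [VoisinHodgeI2002] C. Voisin, *Hodge Theory and Complex Algebraic Geometry I*, §7.3.2, §11.3.3 Thm. 11.40. [cite: VoisinHodgeI2002, §7.3.2]
-/

noncomputable section

open CategoryTheory CategoryTheory.Limits

namespace Literature.AlgebraicGeometry.Motives

namespace AbelianVariety

open Literature.AlgebraicGeometry.HodgeTheory
open Literature.AlgebraicGeometry.Motives.HodgeStructure
open Literature.AlgebraicGeometry.Pohlmann1968 (hodge_one_eq_comapEquiv_of_isIsogeny)

variable [HodgeTensorFacts.{0, 0}]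

/-! ### Isogeny invariance -/

section Isogeny

variable {X X' : AbelianVariety ℂ} {n m : ℕ} (hX : IsSmoothProjective n X.X) (hX' : IsSmoothProjective m X'.X)

/-- **`dim_ℚ Lie Hg(H¹X') = dim_ℚ Lie Hg(H¹X)` for an isogeny `X ⟶ X'`** (`H¹(X') = (g^*)^* H¹(X)` as Hodge structures,
`hodge_one_eq_comapEquiv_of_isIsogeny`; the dimension of `Lie Hg` is an isomorphism invariant, `finrank_hodgeLie_comapEquiv`).
[cite: VoisinHodgeI2002, §7.3.2] [cite: Deligne1982HodgeCycles, I Prop. 3.4] -/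
theorem finrank_hodgeLie_hodge_one_eq_of_isIsogeny {g : X ⟶ X'} (hg : IsIsogeny g) :
    haveI := BettiUniverse.finite hX 1
    haveI := BettiUniverse.finite hX' 1
    Module.finrank ℚ (BettiUniverse.hodge exists_isReal_hodgeModel_holds hX' 1).hodgeLie =
      Module.finrank ℚ (BettiUniverse.hodge exists_isReal_hodgeModel_holds hX 1).hodgeLie := by
  haveI := BettiUniverse.finite hX 1
  haveI := BettiUniverse.finite hX' 1
  rw [hodge_one_eq_comapEquiv_of_isIsogeny hX hX' hg]
  exact finrank_hodgeLie_comapEquiv _ _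

/-- **Isogenous complex abelian varieties have Hodge groups of the same dimension** (on `H¹`). [cite: VoisinHodgeI2002, §7.3.2]
[cite: Deligne1982HodgeCycles, I Prop. 3.4] -/
theorem finrank_hodgeLie_hodge_one_eq_of_isIsogenous (h : IsIsogenous X X') :
    haveI := BettiUniverse.finite hX 1
    haveI := BettiUniverse.finite hX' 1
    Module.finrank ℚ (BettiUniverse.hodge exists_isReal_hodgeModel_holds hX 1).hodgeLie =
      Module.finrank ℚ (BettiUniverse.hodge exists_isReal_hodgeModel_holds hX' 1).hodgeLie := by
  obtain ⟨g, hg⟩ := h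
  exact (finrank_hodgeLie_hodge_one_eq_of_isIsogeny hX hX' hg).symm

end Isogeny

/-! ### Biproducts -/

section Biproduct

variable {J : Type} [Fintype J] [DecidableEq J] {A : J → AbelianVariety ℂ} {d : J → ℕ} {m : ℕ}
  (hA : ∀ j, IsSmoothProjective (d j) (A j).X) (hB : IsSmoothProjective m (⨁ A).X)

/-- **`dim Lie Hg(H¹(⨁ⱼ Aⱼ)) ≤ Σⱼ dim Lie Hg(H¹Aⱼ)`** — the Lie-algebra form of `Hg(X₁ × X₂) ⊆ Hg(X₁) × Hg(X₂)` (Moonen–Zarhin §3),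
via Künneth in degree one (`pi_hodge_one_eq_comapEquiv_biproduct`) and `finrank_hodgeLie_pi_le_sum`.
[cite: MoonenZarhin1999LowDim, §3] [cite: Deligne1982HodgeCycles, I §3.1 and Prop. 3.4] -/
theorem finrank_hodgeLie_hodge_one_biproduct_le_sum :
    haveI := BettiUniverse.finite hB 1
    haveI : ∀ j, Module.Finite ℚ (bettiCohomology (A j).X 1) := fun j => BettiUniverse.finite (hA j) 1
    Module.finrank ℚ (BettiUniverse.hodge exists_isReal_hodgeModel_holds hB 1).hodgeLie ≤
      ∑ j, Module.finrank ℚ (BettiUniverse.hodge exists_isReal_hodgeModel_holds (hA j) 1).hodgeLie := by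
  haveI := BettiUniverse.finite hB 1
  haveI : ∀ j, Module.Finite ℚ (bettiCohomology (A j).X 1) := fun j => BettiUniverse.finite (hA j) 1
  have hpi := pi_hodge_one_eq_comapEquiv_biproduct hA hB exists_isReal_hodgeModel_holds hodgePQ_independent_of_hodgeModel_holds
  have heq := finrank_hodgeLie_comapEquiv (BettiUniverse.hodge exists_isReal_hodgeModel_holds hB 1)
    (LinearEquiv.ofBijective
      (∑ j, BettiUniverse.pull (biproduct.π A j).hom.hom.hom 1 ∘ₗ LinearMap.proj j :
        (∀ j, bettiCohomology (A j).X 1) →ₗ[ℚ] bettiCohomology (⨁ A).X 1)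
      (bijective_sum_pull_biproduct_π A))
  rw [← hpi] at heq
  rw [← heq]
  exact finrank_hodgeLie_pi_le_sum _

end Biproduct

section Const

variable {B : AbelianVariety ℂ} {k a m : ℕ} (hBsp : IsSmoothProjective k B.X)
  (hP : IsSmoothProjective m (⨁ fun _ : Fin (a + 1) => B).X)

/-- **`dim Lie Hg(H¹(⨁_{Fin (a+1)} B)) ≤ dim Lie Hg(H¹B)`** — the Lie-algebra form of `Hg(Bᵐ) = Hg(B)` (Künneth in degree one
and `finrank_hodgeLie_pi_const_le`). [cite: MoonenZarhin1999LowDim, §3] [cite: Deligne1982HodgeCycles, I §3.1 and Prop. 3.4] -/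
theorem finrank_hodgeLie_hodge_one_biproduct_const_le :
    haveI := BettiUniverse.finite hP 1
    haveI := BettiUniverse.finite hBsp 1
    Module.finrank ℚ (BettiUniverse.hodge exists_isReal_hodgeModel_holds hP 1).hodgeLie ≤
      Module.finrank ℚ (BettiUniverse.hodge exists_isReal_hodgeModel_holds hBsp 1).hodgeLie := by
  haveI := BettiUniverse.finite hP 1
  haveI := BettiUniverse.finite hBsp 1
  have hpi := pi_hodge_one_eq_comapEquiv_biproduct (A := fun _ : Fin (a + 1) => B) (fun _ => hBsp) hP
    exists_isReal_hodgeModel_holds hodgePQ_independent_of_hodgeModel_holds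
  have heq := finrank_hodgeLie_comapEquiv (BettiUniverse.hodge exists_isReal_hodgeModel_holds hP 1)
    (LinearEquiv.ofBijective
      (∑ c, BettiUniverse.pull (biproduct.π (fun _ : Fin (a + 1) => B) c).hom.hom.hom 1 ∘ₗ LinearMap.proj c :
        (∀ _ : Fin (a + 1), bettiCohomology B.X 1) →ₗ[ℚ] bettiCohomology (⨁ fun _ : Fin (a + 1) => B).X 1)
      (bijective_sum_pull_biproduct_π fun _ : Fin (a + 1) => B))
  rw [← hpi] at heq
  rw [← heq]
  exact finrank_hodgeLie_pi_const_le _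

end Const

end AbelianVariety

end Literature.AlgebraicGeometry.Motives

end
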